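import Summits.BirchSwinnertonDyer.BirchSwinnertonDyer.Theses.QuadraticBranchSignedControl
import Summits.BirchSwinnertonDyer.BirchSwinnertonDyer.Theorems.QuadraticBranchSignedControlPlusEtaNonsurjFineRoadCM
import Summits.BirchSwinnertonDyer.BirchSwinnertonDyer.Theorems.QuadraticBranchSignedControlPlusEtaNonsurjCorpuzLeiTransferOPEN
import Literature.NumberTheory.EllipticCurves.ZywinaCMImageProofs
import Summits.BirchSwinnertonDyer.Rank1Residual.O6.X4CongruenceAnchor
import HarnessLib

/-!
# Route `QuadraticBranchSignedControl` (rung K8, cell `bsd-potss`), residual crux `PlusEtaMainConjectureNonsurj`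
# (stmt-BirchSwinnertonDyer-19606): the crux BY NAME from «(A) + analytic μ on the CM rows» + «the OPEN transfer binder (analytic-μ form)» +
# «the non-CM rows NOT congruent to a CM row» — v7 `_of` candidate, second (corrected) cut (a `--supports` file; seat `bsd-potss-k8eta-c2` g8)

WHAT. The first v7 candidate (`EtaCMAnchorTransferOf.plusEtaMainConjectureNonsurj_of_cmConjA_of_transfer_of_unanchored`, p556504) re-cut the
non-CM rows by the existence of a CM UNIT anchor datum (a CM curve `A` with `L(A,1) ≠ 0`, `5 ∤ #Ш_an·Tam`, AND a good `a_p = 0` model of `A^{(p*)}`).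
CORRECTION OF RECORD: in 4 of the 9 anchor classes in-table (those of `2700p1`, `675a1`, `14400l1`, `11025b1`; 16 of the 30 non-CM rows) the rank-0
CM members have `v₅(c₆) = 2` — their `5`-twists are ADDITIVE at `5` — so no unit anchor datum exists there and those rows fall into that cut's
«unanchored» stub. THIS FILE gives the sharper cut that needs NO unit anchor: a non-CM row `V` is discharged as soon as it is congruent mod `p` to
ANY CM ROW OF THE CRUX `V″` (a globally minimal CM curve, good at `p` with `a_p = 0` — e.g. the twists of `2700p1`, `675a1`, `14400l1`, `11025b1`,
`900b1`, …), because (C1⁺_η)(V″,p) is what the CM branch of `_of` proves anyway (k8eta-c2 g7's `EtaFineRoad.etaMC_cm_of_bt26_of_conjA_partners_of_analyticMu`: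
(A) on the CM partners + the analytic `μ` on the CM rows, modulo Burungale–Tian `h26` + Kobayashi `h22 h6273`), and the OPEN binder in its
analytic-`μ` form (`CorpuzLei2025_etaPlusMainConjecture_transfer_anMu_OPEN`, APPEND of `…CorpuzLeiTransferOPEN.lean`, p558472 ACCEPTED) transfers it
to `V` using the SAME analytic `μ` at `V″`. So:

  `PlusEtaMainConjectureNonsurj` ⟸ h22 h6273 h26 (named, published) + `hCL` (the OPEN binder, PRE)
    + `hAcm`   : (A) for the additive partners of the CM twists (= `stub_conjA_partners` restricted to CM; OPEN)
    + `hμcm`   : the analytic `μ(L_p⁺(V,η,X)) = 0` on the CM rows (displayed analytic input)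
    + `huncong`: (C1⁺_η) on the non-CM rows NOT congruent mod `p` to any CM row of the crux (proposed stub `stub_etaMC_nonCM_uncongruent`:
                 EMPTY in-table — all 30 non-CM rows below `5·10⁵` are `5`-congruent to a CM row (kernel certificates `EtaModFiveCongruenceRecords`,
                 parts B–F) — OPEN class-wide: g5's class-level structure says `C_ns⁺(5)` classes without a CM member exist).
No modularity / GZK / bsd.S28 / `L₀` / Thm 4.1 / Hatley–Lei / Poitou–Tate / Kitajima–Otsuki enter.

HONEST FRAMING (cell `bsd-potss`; HUMAN RULING D-0036/D-0074): ONE BOOKKEEPING THEOREM (+ its row-level form) — no definition, no new fact, no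
`sorry`, axioms standard; CONDITIONAL on the named facts, on the OPEN binder `hCL` (unrefereed preprint, flag `CL25-eta-plus-dictionary`) and on the
three displayed stub-texts. Not the registered `_of` of skeleton v5 (planner's call); 19606 stays OPEN; nothing booked; BSD(W,p) claimed for no pair.
`--supports stmt-BirchSwinnertonDyer-19606`.

References: [CorpuzLei2025] Thms 1–3 (claim); [BurungaleTian2026] Thm. 2.6; [Kobayashi2003] Thm. 2.2, §4, Thm. 6.2/6.3/7.3, Cor. 7.2;
[CoatesSujatha2005] §3 (A), Thm. 3.4; [GreenbergVatsal2000] Thm. (1.4); [Zywina2015] Prop. 1.14 (CM images are not onto).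
-/

set_option autoImplicit false
set_option linter.dupNamespace false

noncomputable section

open scoped Classical

open CongruenceSubgroup Field Function NumberField IsDedekindDomain WeierstrassCurve
open Literature.NumberTheory.EllipticCurves
open Literature.NumberTheory.EllipticCurves.ModularForms
open Literature.NumberTheory.EllipticCurves.Rank1Residual
open Literature.NumberTheory.EllipticCurves.Rank1Residual.Typed
open Literature.NumberTheory.GaloisRepresentations
open Literature.NumberTheory.GaloisCohomology
open Literature.NumberTheory.EllipticCurves.IwasawaAlgebra
open Literature.NumberTheory.EllipticCurves.IwasawaDual ZpExtension
open Literature.NumberTheory.EllipticCurves.GreenbergVatsal2000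
open Summit.BirchSwinnertonDyer.Rank1Residual.X11b.Levels
open Summit.BirchSwinnertonDyer.Rank1Residual.X11b
open Summit.BirchSwinnertonDyer.Rank1Residual.Additive
open Summit.BirchSwinnertonDyer.Rank1Residual.Additive.SignedTwist
open scoped ContRepresentation
open Summit.BirchSwinnertonDyer.Rank1Residual.AdditivePotMult
open Summit.BirchSwinnertonDyer.Rank1Residual.O6 (ModPCongruent)
open Summit.BirchSwinnertonDyer.BirchSwinnertonDyer.Theses.QuadraticBranchSignedControl

namespace Summit.BirchSwinnertonDyer.BirchSwinnertonDyer.Theorems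

namespace EtaCMCongruentTransfer

/-- **THE CM-CONGRUENT TRANSFER at one row.** `p ≥ 5`; `V″` a globally minimal CM curve, good at `p` with `a_p(V″) = 0` (a CM ROW of the crux:
its tower is never onto — Zywina), at which (C1⁺_η) holds (`hMC″`) and the analytic `μ` vanishes (`hμan″`); `V` globally minimal, good at `p` with
`a_p(V) = 0`, `ModPCongruent V″ V p`. Granted the OPEN binder `hCL` (analytic-`μ` form, PRE): (C1⁺_η)(V,p). CONDITIONAL; nothing booked.
[claim: CorpuzLei2025, status: under-review] [cite: GreenbergVatsal2000, Thm. (1.4)] [cite: Kobayashi2003, §4 Even main conjecture (p. 8)] -/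
theorem quadraticBranchPlusEtaMainConjectureAt_of_congruent_of_transfer
    (hCL : CorpuzLei2025_etaPlusMainConjecture_transfer_anMu_OPEN) (p : ℕ) [hp : Fact p.Prime] (hp5 : 5 ≤ p)
    (V'' : WeierstrassCurve ℚ) [V''.IsElliptic] [V''.IsGloballyMinimal] (hgood'' : V''.HasGoodReductionAtPrime p)
    (hap'' : V''.frobeniusTrace p = 0) (hMC'' : QuadraticBranchPlusEtaMainConjectureAt V'' p)
    (hμan'' : ∀ {N : ℕ} [NeZero N] {f : CuspForm (Gamma0 N) 2}, IsNewformOf V'' f →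
      ∀ (ϖ : ℚ), (if Even (p / 2) then (ϖ : ℝ) * V''.realPeriodRat = plusPeriod f
          else (ϖ : ℝ) * V''.imaginaryPeriodRat = minusPeriod f) →
      ∀ (Lη : IwasawaAlgebra p), IsQuadraticBranchPlusLFunction f p ϖ Lη → HasUnitContent Lη)
    (V : WeierstrassCurve ℚ) [V.IsElliptic] [V.IsGloballyMinimal] (hgood : V.HasGoodReductionAtPrime p)
    (hap : V.frobeniusTrace p = 0) (hcong : ModPCongruent V'' V p) :
    QuadraticBranchPlusEtaMainConjectureAt V p :=
  hCL V V'' p (by omega) hgood hap hgood'' hap'' hcong hMC'' hμan''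

/-- **The crux `PlusEtaMainConjectureNonsurj` BY NAME — v7 `_of` candidate, corrected cut.** From: Kobayashi Thm 2.2η (`h22`), Thm 6.2/6.3/7.3η
(`h6273`), Burungale–Tian Thm 2.6 (`h26`) — named published facts; the OPEN binder `hCL` (Corpuz–Lei 2025, analytic-`μ` form, PRE); (A) on the
additive partners of the CM twists (`hAcm`, OPEN); the analytic `μ = 0` on the CM rows (`hμcm`, displayed); and (C1⁺_η) on the non-CM rows NOT
congruent mod `p` to any CM row of the crux (`huncong`, the proposed stub `stub_etaMC_nonCM_uncongruent` — empty in-table, open class-wide). CM rows: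
`EtaFineRoad.etaMC_cm_of_bt26_of_conjA_partners_of_analyticMu`; non-CM rows congruent to a CM row `V″`: the same theorem at `V″` + the binder
(`quadraticBranchPlusEtaMainConjectureAt_of_congruent_of_transfer`); the rest: `huncong`. CONDITIONAL; closes nothing by itself; nothing booked.
[claim: CorpuzLei2025, status: under-review] [cite: BurungaleTian2026, Thm. 2.6] [cite: Kobayashi2003, Thm. 2.2 (p. 5), §4 (p. 8), Thm. 7.3 i) and Cor. 7.2]
[cite: CoatesSujatha2005, §3 statement (A) and Thm. 3.4] [cite: GreenbergVatsal2000, Thm. (1.4)] [cite: Zywina2015, Prop. 1.14 and Prop. 1.16] -/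
theorem plusEtaMainConjectureNonsurj_of_cmConjA_of_transfer_of_uncongruent
    (h22 : Kobayashi2003.thm22_etaSignedSelmerDual_finite_torsion)
    (h6273 : Kobayashi2003.thm62_63_73_etaColemanPoitouTate)
    (h26 : BurungaleTian2026.thm26_etaKatoSequences_charIdeal_upToP_of_cm)
    (hCL : CorpuzLei2025_etaPlusMainConjecture_transfer_anMu_OPEN)
    (hAcm : ∀ (V : WeierstrassCurve ℚ) [V.IsElliptic] [V.IsGloballyMinimal] (W : WeierstrassCurve ℚ) [W.IsElliptic]
      [W.IsGloballyMinimal] (C : VariableChange ℚ) (p : ℕ) [Fact p.Prime],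
      5 ≤ p → C • W.quadraticTwist ((-1) ^ (p / 2) * p) = V →
      V.HasGoodReductionAtPrime p → V.frobeniusTrace p = 0 →
      ¬ (∀ m : ℕ, V.HasSurjectiveModNGaloisRep (p ^ m : ℕ)) → V.HasCM →
      ∀ (κ : ZpExtension ℚ p), κ.IsCyclotomic →
        ∃ (γ : absoluteGaloisGroup ℚ) (D : W.FineSelmerDualData κ γ),
          Module.Finite ℤ_[p] (RestrictScalars ℤ_[p] (IwasawaAlgebra p) D.X))
    (hμcm : ∀ (V : WeierstrassCurve ℚ) [V.IsElliptic] [V.IsGloballyMinimal] (p : ℕ) [Fact p.Prime],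
      5 ≤ p → V.HasGoodReductionAtPrime p → V.frobeniusTrace p = 0 →
      ¬ (∀ m : ℕ, V.HasSurjectiveModNGaloisRep (p ^ m : ℕ)) → V.HasCM →
      ∀ {N : ℕ} [NeZero N] {f : CuspForm (Gamma0 N) 2}, IsNewformOf V f →
        ∀ (ϖ : ℚ), (if Even (p / 2) then (ϖ : ℝ) * V.realPeriodRat = plusPeriod f
            else (ϖ : ℝ) * V.imaginaryPeriodRat = minusPeriod f) →
        ∀ (Lη : IwasawaAlgebra p), IsQuadraticBranchPlusLFunction f p ϖ Lη → HasUnitContent Lη)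
    (huncong : ∀ (V : WeierstrassCurve ℚ) [V.IsElliptic] [V.IsGloballyMinimal] (p : ℕ) [Fact p.Prime],
      5 ≤ p → V.HasGoodReductionAtPrime p → V.frobeniusTrace p = 0 →
      ¬ (∀ m : ℕ, V.HasSurjectiveModNGaloisRep (p ^ m : ℕ)) → ¬ V.HasCM →
      ¬ (∃ (V'' : WeierstrassCurve ℚ) (_ : V''.IsElliptic) (_ : V''.IsGloballyMinimal),
          V''.HasCM ∧ V''.HasGoodReductionAtPrime p ∧ V''.frobeniusTrace p = 0 ∧ ModPCongruent V'' V p) →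
      QuadraticBranchPlusEtaMainConjectureAt V p) :
    PlusEtaMainConjectureNonsurj := by
  intro V _ _ p _ hp5 hgood hap hns
  have hp2 : p ≠ 2 := by omega
  -- the CM branch of the crux, for ANY CM row (k8eta-c2 g7)
  have hcmRows := EtaFineRoad.etaMC_cm_of_bt26_of_conjA_partners_of_analyticMu h26 h22 h6273 hAcm hμcm
  by_cases hCM : V.HasCM
  · exact hcmRows V p hp5 hgood hap hns hCM
  · by_cases hcg : ∃ (V'' : WeierstrassCurve ℚ) (_ : V''.IsElliptic) (_ : V''.IsGloballyMinimal),
        V''.HasCM ∧ V''.HasGoodReductionAtPrime p ∧ V''.frobeniusTrace p = 0 ∧ ModPCongruent V'' V p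
    · obtain ⟨V'', _, _, hCM'', hgood'', hap'', hcong⟩ := hcg
      have hns'' : ¬ (∀ m : ℕ, V''.HasSurjectiveModNGaloisRep (p ^ m : ℕ)) := by
        intro h
        exact V''.not_hasSurjectiveModNGaloisRep_of_hasCM hCM'' (Fact.out) hp2 (by simpa using h 1)
      exact quadraticBranchPlusEtaMainConjectureAt_of_congruent_of_transfer hCL p hp5 V'' hgood'' hap''
        (hcmRows V'' p hp5 hgood'' hap'' hns'' hCM'') (hμcm V'' p hp5 hgood'' hap'' hns'' hCM'') V hgood hap hcong
    · exact huncong V p hp5 hgood hap hns hCM hcg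

end EtaCMCongruentTransfer

end Summit.BirchSwinnertonDyer.BirchSwinnertonDyer.Theorems

end
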